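import Mathlib
import Summits.CriticalPhenomena.CardyFormulaZ2.Theorems.CardyFlipRussoSquareFromVoronoiHubFaithfulPart8
import Literature.Probability.LatticeModels.DelaunayGraph
import Literature.Probability.Percolation.VoronoiCrossing

/-!
# Fat tubes in defect-free Voronoi tessellations, Part 1: local finiteness, small cells, deep points

Crux `Summit.CriticalPhenomena.CardyFormulaZ2.Theses.CardyFlipRusso.SquareFromVoronoiHub`
(stmt-CriticalPhenomena-6434), line `Sketch`, stub `stub_fatTube` (deterministic Voronoi
geometry behind the faithful discretisation K1).  This first part collects the colour-blind
local facts used by the fat-tube construction, for nucleus sets `X = B ∪ W ⊆ ℂ` that are only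
assumed to satisfy the clauses of the no-defect event locally:

* `finite_of_isBounded_of_sep` — a bounded set whose points are pairwise `≥ r` apart is finite
  (so nuclei are locally finite under the separation clause (ii));
* `isClosed_voronoiCell'`, `voronoiCell_subset_ball` — cells are closed, and a cell whose
  `ρ`-disc about the nucleus has no empty `ρ`-disc lies in `ball nucleus ρ` (clause (i));
* `exists_black_cell` — a black point deep inside the window lies in the cell of a BLACK nucleus
  at distance `< ρ` (nearest nuclei exist by local finiteness);
* `dist_sq_sub_dist_sq` — the functional `z ↦ |z - w|² - |z - b|²` is affine;
  `convex_setOf_deep` — the `μ`-DEEP points of a nucleus `b`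
  (`2 μ |w - b| ≤ |z - w|² - |z - b|²` for every white nucleus `w`) form a convex set, containing
  `b` itself (`self_mem_setOf_deep`);
* `ball_subset_setOf_infDist_lt_of_deep` (= the registered sub-goal `stub_fatTube_part1`) — the
  open `μ`-ball about a `μ`-deep point of a black nucleus is STRICTLY black
  (`infDist · B < infDist · W`), with no closedness or finiteness assumption on `B`, `W`.
-/

noncomputable section

namespace Summit.CriticalPhenomena.CardyFormulaZ2.Cruxes.SquareFromVoronoiHub.VoronoiBlocks.Faithful

open scoped Topology RealInnerProductSpace
open Set Metric
open Literature.Probability.Percolation (blackRegion mem_blackRegion)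
open Literature.Probability.LatticeModels (voronoiCell mem_voronoiCell_iff self_mem_voronoiCell)

/-! ### Local finiteness from separation -/

/-- **Separated bounded sets are finite**: if any two points of the bounded set `Q ⊆ ℂ` at
distance `< r` coincide (`r > 0`), then `Q` is finite (a finite `r`-net of `Q` is all of `Q`).
[folklore] -/
theorem finite_of_isBounded_of_sep {Q : Set ℂ} {r : ℝ} (hr : 0 < r) (hQ : Bornology.IsBounded Q)
    (hsep : ∀ p ∈ Q, ∀ q ∈ Q, dist p q < r → p = q) : Q.Finite := by
  obtain ⟨R, hR⟩ := hQ.subset_closedBall 0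
  have htb : TotallyBounded Q := (isCompact_closedBall (0 : ℂ) R).totallyBounded.subset hR
  obtain ⟨t, htQ, htfin, hcov⟩ := finite_approx_of_totallyBounded htb r hr
  refine htfin.subset fun p hp => ?_
  obtain ⟨y, hy, hpy⟩ := mem_iUnion₂.1 (hcov hp)
  obtain rfl : p = y := hsep p hp y (htQ hy) (mem_ball.1 hpy)
  exact hy

/-! ### Cells: closed, and small inside the window -/

/-- Voronoi cells are closed. [folklore] -/
theorem isClosed_voronoiCell' (X : Set ℂ) (p : ℂ) : IsClosed (voronoiCell X p) := by
  have e : voronoiCell X p = ⋂ q ∈ X, {x : ℂ | dist x p ≤ dist x q} := by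
    ext x; simp only [mem_voronoiCell_iff, mem_iInter, mem_setOf_eq]
  rw [e]
  exact isClosed_biInter fun q _ =>
    isClosed_le (continuous_id.dist continuous_const) (continuous_id.dist continuous_const)

/-- **Cells are small** (clause (i)): if every point of `closedBall p ρ` has a nucleus of `X` at
distance `< ρ`, then `voronoiCell X p ⊆ ball p ρ` (a cell point at distance `≥ ρ` from `p`
would give, by convexity of the cell, a cell point at distance exactly `ρ`, which has a
strictly closer nucleus). [folklore] -/
theorem voronoiCell_subset_ball {X : Set ℂ} {p : ℂ} {ρ : ℝ} (hρ : 0 < ρ)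
    (hcov : ∀ z ∈ closedBall p ρ, ∃ q ∈ X, dist z q < ρ) : voronoiCell X p ⊆ ball p ρ := by
  intro z hz
  rcases lt_or_ge (dist z p) ρ with h | h
  · exact mem_ball.2 h
  exfalso
  have hdpos : 0 < dist z p := hρ.trans_le h
  set t : ℝ := ρ / dist z p with ht
  have ht0 : 0 ≤ t := div_nonneg hρ.le dist_nonneg
  have ht1 : t ≤ 1 := (div_le_one hdpos).2 h
  have hz'cell : p + t • (z - p) ∈ voronoiCell X p :=
    (convex_voronoiCell X p).add_smul_sub_mem (self_mem_voronoiCell X p) hz ⟨ht0, ht1⟩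
  have hdist : dist (p + t • (z - p)) p = ρ := by
    rw [dist_eq_norm, add_sub_cancel_left, norm_smul, Real.norm_eq_abs, abs_of_nonneg ht0,
      ← dist_eq_norm, ht, div_mul_cancel₀ _ hdpos.ne']
  obtain ⟨q, hq, hq'⟩ := hcov _ (mem_closedBall.2 hdist.le)
  have := hz'cell q hq
  linarith

/-- **A black point deep inside the window lies in the cell of a black nucleus at distance
`< ρ`** (clauses (o), (i), (ii)): the black nuclei within `ρ` of `z` form a finite non-empty set,
and a nearest one is a nearest nucleus overall. [folklore] -/
theorem exists_black_cell {B W V : Set ℂ} {ρ r₂ : ℝ} (hρ : 0 < ρ) (hr₂ : 0 < r₂)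
    (hB : B.Nonempty) (hcov : ∀ z ∈ V, ∃ p ∈ B ∪ W, dist z p < ρ)
    (hsep : ∀ p ∈ B ∪ W, ∀ q ∈ B ∪ W, p ∈ V → dist p q < r₂ → p = q)
    {z : ℂ} (hzV : closedBall z ρ ⊆ V) (hz : z ∈ blackRegion B W) :
    ∃ b ∈ B, z ∈ voronoiCell (B ∪ W) b ∧ dist z b < ρ := by
  have hnear : ∃ b ∈ B, dist z b < ρ := by
    obtain ⟨p, hp, hzp⟩ := hcov z (hzV (mem_closedBall_self hρ.le))
    rcases hp with hp | hp
    · exact ⟨p, hp, hzp⟩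
    · have h1 : infDist z W < ρ := (infDist_le_dist_of_mem hp).trans_lt hzp
      exact (infDist_lt_iff hB).1 ((mem_blackRegion.1 hz).trans_lt h1)
  set Q : Set ℂ := B ∩ ball z ρ with hQ
  have hQfin : Q.Finite := by
    refine finite_of_isBounded_of_sep hr₂ (isBounded_ball.subset inter_subset_right)
      fun p hp q hq hpq => ?_
    exact hsep p (Or.inl hp.1) q (Or.inl hq.1) (hzV (ball_subset_closedBall hp.2)) hpq
  have hQne : Q.Nonempty := by
    obtain ⟨b, hb, hzb⟩ := hnear
    exact ⟨b, hb, mem_ball'.2 hzb⟩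
  obtain ⟨b₀, hb₀Q, hmin⟩ := Q.exists_min_image (fun b => dist z b) hQfin hQne
  have hb₀z : dist z b₀ < ρ := mem_ball'.1 hb₀Q.2
  have hallB : ∀ b ∈ B, dist z b₀ ≤ dist z b := fun b hb => by
    rcases lt_or_ge (dist z b) ρ with h | h
    · exact hmin b ⟨hb, mem_ball'.2 h⟩
    · exact hb₀z.le.trans h
  have hinf : infDist z B = dist z b₀ :=
    le_antisymm (infDist_le_dist_of_mem hb₀Q.1) ((le_infDist hB).2 fun b hb => hallB b hb)
  refine ⟨b₀, hb₀Q.1, mem_voronoiCell_iff.2 fun q hq => ?_, hb₀z⟩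
  rcases hq with hq | hq
  · exact hallB q hq
  · rw [← hinf]
    exact (mem_blackRegion.1 hz).trans (infDist_le_dist_of_mem hq)

/-! ### Deep points -/

/-- The functional `z ↦ |z - w|² - |z - b|²` is affine:
`|z - w|² - |z - b|² = |w|² - |b|² - 2⟪w - b, z⟫`. [folklore] -/
theorem dist_sq_sub_dist_sq (z w b : ℂ) :
    dist z w ^ 2 - dist z b ^ 2 = ‖w‖ ^ 2 - ‖b‖ ^ 2 - 2 * ⟪w - b, z⟫ := by
  simp only [dist_eq_norm]
  rw [norm_sub_sq_real, norm_sub_sq_real, inner_sub_left, real_inner_comm z w, real_inner_comm z b]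
  ring

/-- Increment of the affine functional `|· - w|² - |· - b|²` between two points. [folklore] -/
theorem dist_sq_sub_dist_sq_sub (y z w b : ℂ) :
    (dist y w ^ 2 - dist y b ^ 2) - (dist z w ^ 2 - dist z b ^ 2) = -2 * ⟪w - b, y - z⟫ := by
  rw [dist_sq_sub_dist_sq, dist_sq_sub_dist_sq, inner_sub_right]; ring

/-- **The set of `μ`-deep points of the nucleus `b` is convex** (an intersection of closed
half-planes, one for each `w ∈ W`). [folklore] -/
theorem convex_setOf_deep (W : Set ℂ) (b : ℂ) (μ : ℝ) :
    Convex ℝ {z : ℂ | ∀ w ∈ W, 2 * μ * dist w b ≤ dist z w ^ 2 - dist z b ^ 2} := by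
  have e : {z : ℂ | ∀ w ∈ W, 2 * μ * dist w b ≤ dist z w ^ 2 - dist z b ^ 2} =
      ⋂ w ∈ W, {z : ℂ | ⟪w - b, z⟫ ≤ (‖w‖ ^ 2 - ‖b‖ ^ 2 - 2 * μ * dist w b) / 2} := by
    ext z
    simp only [mem_setOf_eq, mem_iInter]
    refine forall₂_congr fun w _ => ?_
    rw [dist_sq_sub_dist_sq]
    constructor <;> intro h <;> linarith
  rw [e]
  exact convex_iInter₂ fun w _ => convex_halfSpace_le (innerₛₗ ℝ (w - b)).isLinear _

/-- A nucleus all of whose white competitors are `≥ r₂ ≥ 2μ` away is `μ`-deep for itself.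
[folklore] -/
theorem self_mem_setOf_deep {W : Set ℂ} {b : ℂ} {μ r₂ : ℝ} (h2 : 2 * μ ≤ r₂)
    (hsepW : ∀ w ∈ W, r₂ ≤ dist w b) :
    ∀ w ∈ W, 2 * μ * dist w b ≤ dist b w ^ 2 - dist b b ^ 2 := by
  intro w hw
  rw [dist_self, dist_comm b w]
  have h := hsepW w hw
  have h' : 2 * μ * dist w b ≤ dist w b * dist w b :=
    mul_le_mul_of_nonneg_right (h2.trans h) dist_nonneg
  nlinarith only [h']

/-- **Deep points have strictly black balls.**  If `b ∈ B`, every `w ∈ W` is at distance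
`≥ r₂ > 0` from `b`, and `z` is `μ`-deep for `b` (`2μ|w - b| ≤ |z - w|² - |z - b|²` for all
`w ∈ W`), then every point `y` of the open ball `ball z μ` is strictly closer to `B` than to `W`:
`|y - w|² ≥ |y - b|² + 2(μ - |y - z|) r₂` uniformly in `w ∈ W`, by the affine increment formula.
No closedness of `B`, `W` is needed. [folklore] -/
theorem ball_subset_setOf_infDist_lt_of_deep {B W : Set ℂ} {b z : ℂ} {μ r₂ : ℝ} (hb : b ∈ B)
    (hW : W.Nonempty) (hr₂ : 0 < r₂) (hsepW : ∀ w ∈ W, r₂ ≤ dist w b)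
    (hdeep : ∀ w ∈ W, 2 * μ * dist w b ≤ dist z w ^ 2 - dist z b ^ 2) :
    ball z μ ⊆ {y : ℂ | infDist y B < infDist y W} := by
  intro y hy
  rw [mem_ball] at hy
  have hm₀ : 0 < 2 * (μ - dist y z) * r₂ := by nlinarith only [hy, hr₂]
  have key : ∀ w ∈ W, dist y b ^ 2 + 2 * (μ - dist y z) * r₂ ≤ dist y w ^ 2 := by
    intro w hw
    have h1 := hdeep w hw
    have h2 := dist_sq_sub_dist_sq_sub y z w b
    have h3 : ⟪w - b, y - z⟫ ≤ ‖w - b‖ * ‖y - z‖ := real_inner_le_norm _ _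
    rw [← dist_eq_norm, ← dist_eq_norm] at h3
    have h4 := mul_le_mul_of_nonneg_left (hsepW w hw) (by linarith only [hy] : (0:ℝ) ≤ 2 * (μ - dist y z))
    nlinarith only [h1, h2, h3, h4]
  have hD' : dist y b < Real.sqrt (dist y b ^ 2 + 2 * (μ - dist y z) * r₂) :=
    (Real.lt_sqrt dist_nonneg).2 (by linarith only [hm₀])
  show infDist y B < infDist y W
  calc infDist y B ≤ dist y b := infDist_le_dist_of_mem hb
    _ < Real.sqrt (dist y b ^ 2 + 2 * (μ - dist y z) * r₂) := hD'
    _ ≤ infDist y W := (le_infDist hW).2 fun w hw => by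
        calc Real.sqrt (dist y b ^ 2 + 2 * (μ - dist y z) * r₂)
            ≤ Real.sqrt (dist y w ^ 2) := Real.sqrt_le_sqrt (key w hw)
          _ = dist y w := Real.sqrt_sq dist_nonneg

/-- **Registered sub-goal `stub_fatTube_part1`**: deep points of a black nucleus have strictly
black `μ`-balls (= `ball_subset_setOf_infDist_lt_of_deep`). [folklore] -/
theorem stub_fatTube_part1 : ∀ {B W : Set ℂ} {b z : ℂ} {μ r₂ : ℝ}, b ∈ B → W.Nonempty → 0 < r₂ → (∀ w ∈ W, r₂ ≤ dist w b) → (∀ w ∈ W, 2 * μ * dist w b ≤ dist z w ^ 2 - dist z b ^ 2) → ball z μ ⊆ {y : ℂ | infDist y B < infDist y W} :=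
  fun hb hW hr₂ hsepW hdeep => ball_subset_setOf_infDist_lt_of_deep hb hW hr₂ hsepW hdeep

end Summit.CriticalPhenomena.CardyFormulaZ2.Cruxes.SquareFromVoronoiHub.VoronoiBlocks.Faithful

end
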